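import Summits.BirchSwinnertonDyer.BirchSwinnertonDyer.Theorems.ErratumRoadFiveNonSurjCornerHybridKDisjoint
import Summits.BirchSwinnertonDyer.BirchSwinnertonDyer.Theorems.ErratumRoadFiveNonSurjCornerAuxPrimeKDisjoint
import Summits.BirchSwinnertonDyer.BirchSwinnertonDyer.Theorems.SemiOrdinaryEisensteinDescentShaTwoCochainShell
import Summits.BirchSwinnertonDyer.BirchSwinnertonDyer.Theorems.SemiOrdinaryEisensteinDescentShaTwoCochainBridgeAssemblyCriterion
import Summits.BirchSwinnertonDyer.BirchSwinnertonDyer.Theorems.SemiOrdinaryEisensteinDescentShaTwoCochainClassReadout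
import HarnessLib

/-!
# Route `ErratumRoadFive` (rung K2), crux `NonSurjCorner` (item stmt-BirchSwinnertonDyer-19065), line `Lines/hybrid.lean`:
# GLUE #26 — composition of the r24 skeleton candidate: FOUR stubs {deep witness, twin-lower supplies, fifteen facts, 2 + 4 names};
# slot 6‴ (K-disjointness on the inert frames) is now a TREE THEOREM (`AuxPrimeSupplyCorner.stub_cornerKDisjoint57`, p660784) and the
# levelwise Cassels–Tate name of slot 5 is DISCHARGED by the tree's Ш²-cochain bridge (item 20191's content, route-independent parts)
# (cell `bsd-stepL`, seat `bsd-stepL-corner-p1` g19; `--supports stmt-BirchSwinnertonDyer-19065 --as helper`)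

WHY THIS FILE. Glue #25 (`…HybridKDisjoint`, g18) composed r23's five stubs into the route decl `Theses.ErratumRoadFive.NonSurjCorner`; its sixth
binder `hKD` (r23 slot 6‴ = K-disjointness `ρ̄_{E,p}(Γ_K) = ρ̄_{E,p}(Γ_ℚ)` for `K` imaginary quadratic with `p` inert and unramified, at every
(T4′) corner pair) was PROVED verbatim by this seat (`…AuxPrimeKDisjoint`, p660784). Plugging the theorem in gives the composition of r24 with FOUR
binders: the ∃-shaped deep witness (slot 1′), the ∃-shaped twin-lower supplies (slot 2″), the fifteen published facts (slot 3) and the 2 + 4 published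
Gross ∕ Shimura names (slot 5: r23's fourth Shimura name `∀ K, casselsTate_levelInputs K` — Milne ADT I §6 at the levels `p^{M₀}` — is a TREE
THEOREM, the Ш²-cochain bridge of the `SemiOrdinaryEisensteinDescent` files (closed item 20191), re-composed here from its three route-independent
parts exactly as in `AdditiveBranchIMCGordTwoRankZeroOffCaseOneAbstractKolyvaginDivisibility`; so it is SUPPLIED, not asked). Every
identity-component ∕ label ∕ auxiliary-prime ∕ image-disjointness object of r10–r23's slot 6 is now DERIVED in the kernel: nothing of slot 6 remains.
* `nonSurjCorner_of_deepWitness_of_twinLowerSupply_of_fifteenFacts_of_twoPlusFourNames_pAnchor` (the Cassels–Tate level inputs are composed INLINE from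
  the three route-independent tree theorems; an unconditional stand-alone copy exists as `ShaTwoCochainTheta.casselsTate_levelInputs_of_shaTwoCochainBridge`).

HONEST FRAMING: ONE THEOREM (no definition, no named fact, no `sorry`); CONDITIONAL on the four displayed binders (two research-grade ∃-stubs, two
citable bundles of published facts, 15 + 2 + 4 = 21 names); no further stub proved here; 19065 NOT closed by this file; nothing about any curve's BSD; BSD is not advanced; T7.
References (locators only): [cite: GrossLMS1991, §3, §6, §9] [cite: Serre1972, §2.2, §2.6] [cite: Zywina2015, §1.3, Thm. 1.4] [cite: Kato2004Asterisque, Thm. 12.4]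
[cite: Cha2005, Thm. 21] [cite: PastenShimura2024, Lemma 6.18] [cite: MilneADT2006, Ch. I, Thm. 4.10 (a), §6 Thm. 6.13 (a)].
-/

set_option autoImplicit false
set_option linter.dupNamespace false -- `Summit.BirchSwinnertonDyer.BirchSwinnertonDyer` (summit = problem), tree-wide

noncomputable section

open scoped Classical NumberField Pointwise MatrixGroups ModularForm

namespace Summit.BirchSwinnertonDyer.BirchSwinnertonDyer.Theorems

open CongruenceSubgroup WeierstrassCurve NumberField IsDedekindDomain Field Rat.HeightOneSpectrum
  Literature.NumberTheory.EllipticCurves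
  Literature.NumberTheory.EllipticCurves.ModularForms
  Literature.NumberTheory.Automorphic
  Literature.NumberTheory.EllipticCurves.Rank1Residual
  Literature.NumberTheory.EllipticCurves.Rank1Residual.Typed
  Literature.NumberTheory.EllipticCurves.Wuthrich2014
  Literature.NumberTheory.EllipticCurves.SteinWuthrich2013
  Literature.NumberTheory.EllipticCurves.Greenberg1999
  Literature.NumberTheory.EllipticCurves.Kato2004
  Literature.NumberTheory.EllipticCurves.BarriosEtAl2025
  Literature.NumberTheory.EllipticCurves.EmertonPollackWeston2006
  Literature.NumberTheory.EllipticCurves.ShimuraCMFamily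
  Literature.NumberTheory.GaloisRepresentations Literature.NumberTheory.GaloisCohomology
  Summit.BirchSwinnertonDyer.Rank1Residual
  Summit.BirchSwinnertonDyer.Rank1Residual.X11b
  Summit.BirchSwinnertonDyer.Rank1Residual.X11b.Three.Koly
  Summit.BirchSwinnertonDyer.BirchSwinnertonDyer.Theses.ErratumRoadFive

/-! ### Glue #26 -/

/-- **GLUE #26 — glue #25 with slot 6‴ (K-disjointness on the inert frames) DISCHARGED by the tree theorem
`AuxPrimeSupplyCorner.stub_cornerKDisjoint57`** (p660784) **and the Cassels–Tate name of slot 5 SUPPLIED** (inline: the tree's Ш²-cochain bridge `ShaTwoCochainTheta.casselsTate_levelInputs_of_readout_vanishing_flip`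
∘ `hbridge_of_readout_criterion` ∘ `ShaTwoCochain.classBarInv_readout_eq_zero_of_criterion`, Milne ADT I §6 at the levels `p^{M₀}`).
Binders: `hWit` (slot 1′: ONE deep witness per deep corner pair) → `hSup2` (slot 2″: the two twin-lower supplies per pair) → `hF3` (fifteen published facts) →
`hMax2` (two Gross names) → `hShim4` (FOUR Shimura names: Friedberg–Hoffstein inert twist, Jacquet–Langlands parametrisation data, Pasten's component orders,
the printed CM primitives for irreducible images) → `NonSurjCorner`. No slot-6 object (item 27982's (B6), LAB′, the auxiliary-prime supply, (K)) is a binder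
any more. CONDITIONAL; 19065 NOT closed; nothing booked; T7. [cite: GrossLMS1991, §9] [cite: Serre1972, §2.2, §2.6] [cite: Zywina2015, Thm. 1.4]
[cite: MilneADT2006, Ch. I §6 Thm. 6.13 (a)] -/
theorem nonSurjCorner_of_deepWitness_of_twinLowerSupply_of_fifteenFacts_of_twoPlusFourNames_pAnchor
    -- slot 1′ (r19): ONE DEEP WITNESS per deep corner pair (slots 1 + 2b of r18 merged, ∃-recut)
    (hWit : ∀ (W : WeierstrassCurve ℚ) [W.IsElliptic] [W.IsGloballyMinimal] (p : ℕ) [Fact p.Prime],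
        ClassX11b W p → ¬ Surj W p → (p = 5 ∨ p = 7) → p ∣ padicValInt p W.minimalDiscriminantInt →
        ¬ Ram W p → (∃ s : ℚ, shaAn W = (s : ℂ) ∧ 0 < padicValRat p s) →
        ∃ (N : ℕ) (_ : NeZero N) (K : Type) (_ : Field K) (_ : NumberField K)
          (Dt : ModularParametrizationData W N) (H : HeegnerDatum N (NumberField.discr K)) (ι : K →+* ℂ)
          (P : (W.baseChange K).toAffine.Point),
          W.conductorNorm ℤ = N ∧ IsImaginaryQuadratic K ∧ 4 < (NumberField.discr K).natAbs ∧
          SatisfiesHeegnerHypothesis N K ∧ (W.quadraticTwist (NumberField.discr K : ℚ)).entireLFunction 1 ≠ 0 ∧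
          WeierstrassCurve.Affine.Point.map ι.toRatAlgHom P = heegnerPointComplex Dt H ∧ ¬ (p : ℤ) ∣ Dt.c ∧
          ((∃ (d₁ : KolyvaginHeegnerData Dt H.β ι 1) (y : (W.baseChange K).toAffine.Point),
              WeierstrassCurve.Affine.Point.map (W' := W) (algebraMap K (ringClassField K ι 1)).toRatAlgHom y =
                d₁.derivedPoint ∧
              ∃ Q : (W.baseChange K).toAffine.Point, ((p ^ (padicValNat p W.tamagawaProduct + 1) : ℕ) : ℤ) • Q = y) →
            ∃ M : ℕ, M ≤ padicValNat p W.tamagawaProduct ∧ CertificateAt Dt H.β ι p M) ∧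
          (∀ (Wd : WeierstrassCurve ℚ) [Wd.IsElliptic] [Wd.IsGloballyMinimal] (Cd : VariableChange ℚ),
            Cd • W.quadraticTwist (NumberField.discr K : ℚ) = Wd →
            ClassX11a Wd p → ¬ Surj Wd p → p ∣ padicValInt p Wd.minimalDiscriminantInt →
            ∀ {N : ℕ} [NeZero N] (f : CuspForm (Gamma0 N) 2), IsNewformOf Wd f →
            ∀ (ϖ : ℚ), (ϖ : ℝ) * Wd.realPeriodRat = plusPeriod f →
            ∀ (a : ℚ_[p]) (L : PowerSeries ℚ_[p]),
              (Wd.HasSplitMultiplicativeReductionAtPrime p → a = 1) →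
              (¬ Wd.HasSplitMultiplicativeReductionAtPrime p → a = -1) →
              IsMultPAdicLFunctionOf f p a L →
              ∃ n : ℕ, ‖PowerSeries.coeff n (PowerSeries.C ((ϖ : ℚ) : ℚ_[p]) * L)‖ = 1))
    -- slot 2″ (r20): the twin-lower SUPPLIES of every corner pair (∃-shape): inert frames (`FHTwinLowerSupplyAt`) ∧ the MAX frame
    (hSup2 : ∀ (W : WeierstrassCurve ℚ) [W.IsElliptic] [W.IsGloballyMinimal] (p : ℕ) [Fact p.Prime],
        ClassX11b W p → ¬ Surj W p → (p = 5 ∨ p = 7) → p ∣ padicValInt p W.minimalDiscriminantInt → ¬ Ram W p →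
        FHTwinLowerSupplyAt W p ∧
        (∃ (K : Type) (_ : Field K) (_ : NumberField K), IsImaginaryQuadratic K ∧ 4 < (NumberField.discr K).natAbs ∧
          SatisfiesHeegnerHypothesis (W.conductorNorm ℤ) K ∧ SatisfiesHeegnerHypothesis 2 K ∧
          (W.quadraticTwist (NumberField.discr K : ℚ)).entireLFunction 1 ≠ 0 ∧
          ∀ (Wd : WeierstrassCurve ℚ) [Wd.IsElliptic] [Wd.IsGloballyMinimal] (Cd : VariableChange ℚ),
            Cd • W.quadraticTwist (NumberField.discr K : ℚ) = Wd → ¬ Surj Wd p → Typed.MissingLowerBoundAt Wd p))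
    -- slot 3 (r14): FIFTEEN named facts
    (hF3 :
      (∀ (N : ℕ) [NeZero N] (W : WeierstrassCurve ℚ) (K : Type) [Field K] [NumberField K], Literature.NumberTheory.EllipticCurves.gross_zagier N W K) ∧
      (∀ (N : ℕ) [NeZero N] (W : WeierstrassCurve ℚ) (K : Type) [Field K] [NumberField K], Literature.NumberTheory.EllipticCurves.kolyvagin N W K) ∧
      Literature.NumberTheory.EllipticCurves.Wuthrich2014.sha_dvd_analyticSha ∧
      Literature.NumberTheory.EllipticCurves.rank_eq_analyticRank_of_analyticRank_le_one ∧
      Literature.NumberTheory.EllipticCurves.ModularForms.exists_isNewformOf ∧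
      Literature.NumberTheory.EllipticCurves.friedbergHoffstein_exists_heegnerField_split_twist_ne_zero ∧
      Literature.NumberTheory.EllipticCurves.ModularForms.mazur_not_dvd_maninConstant_of_odd ∧
      Literature.NumberTheory.EllipticCurves.SteinWuthrich2013.thm61_splitMultiplicative ∧
      Literature.NumberTheory.EllipticCurves.SteinWuthrich2013.thm61_nonsplitMultiplicative ∧
      (∀ (W : WeierstrassCurve ℚ) [W.IsElliptic] [W.IsGloballyMinimal] (p : ℕ) [Fact p.Prime], Literature.NumberTheory.EllipticCurves.greenberg_stevens (W := W) (p := p)) ∧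
      Literature.NumberTheory.EllipticCurves.Cha2005.rmk25_pow_dvd_card_sha_primary_of_certificate ∧
      Literature.NumberTheory.EllipticCurves.Kato2004.thm12_4 ∧
      Literature.NumberTheory.EllipticCurves.Kato2004.exists_multDivisibilityInputs_nonsplit_contra ∧
      Literature.NumberTheory.EllipticCurves.Kato2004.exists_multDivisibilityInputs_split_contra ∧
      Literature.NumberTheory.EllipticCurves.Kato2004.exists_multDivisibilityInputs_fine_contra)
    -- slot 5, conjunct 1 (r16): TWO Gross names
    (hMax2 : GrossLMS1991.prop37_2_frobeniusCongruence ∧ Gross1991_heegnerPoint_sub_ratTorsion_mem_E0_imageFree)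
    -- slot 5, conjunct 2 (r24): FOUR Shimura names (r22's five minus the levelwise Cassels–Tate name, a tree theorem)
    (hShim4 : friedbergHoffstein_exists_twist_ne_zero_inertAt ∧ nonempty_shimuraParametrizationData ∧
      PastenShimura2024_componentOrders ∧ shimuraCurve_heegnerSystem_primitivesFromFiveIrr) :
    Summit.BirchSwinnertonDyer.BirchSwinnertonDyer.Theses.ErratumRoadFive.NonSurjCorner :=
  nonSurjCorner_of_deepWitness_of_twinLowerSupply_of_fifteenFacts_of_twoPlusFiveNamedInputs_of_KDisjoint_pAnchor hWit hSup2 hF3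
    hMax2 ⟨hShim4.1, hShim4.2.1, hShim4.2.2.1,
      -- the levelwise Cassels–Tate inputs at every number field: the tree's Ш²-cochain bridge (closed item 20191's content),
      -- composed from its three route-independent parts (as in `AdditiveBranchIMCGordTwoRankZeroOffCaseOneAbstractKolyvaginDivisibility`)
      fun K _ _ ↦ ShaTwoCochainTheta.casselsTate_levelInputs_of_readout_vanishing_flip K
        (ShaTwoCochainTheta.hbridge_of_readout_criterion K (ShaTwoCochain.classBarInv_readout_eq_zero_of_criterion K)),
      hShim4.2.2.2⟩
    AuxPrimeSupplyCorner.stub_cornerKDisjoint57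

end Summit.BirchSwinnertonDyer.BirchSwinnertonDyer.Theorems

end
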